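import Mathlib
import Summits.ResolutionOfSingularities.ResolutionOfSingularities.Theorems.RadicialJungCleanModelsCleanProp44SideFamilyClassification
import HarnessLib

/-!
# Route `RadicialJung`, crux `CleanModels` (stmt-ResolutionOfSingularities-15917), line `Sketch` rev 35, stub 6 `stub_cleanProp44` (X44c):
# CLEAN-PERMISSIBILITY OF EXCEPTIONAL CURVES AT THE POINTS OF A BLOWING UP — ANY CENTRE, ANY TRANSVERSAL CLEAN COMPONENTS (scheme level)

Seat decomp-res-hand-2 g19 (structural hand).  Brick (v) of hand-2 g18's census (`Cruxes/CleanModels/Lines/Sketch-memo-hand2-g18-stubs-5-7.md` §2 (a)):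
the scheme-level classification ✓ `cleanPermissibleAt_exceptionalCurve_or_obstruction` (`…CleanProp44NearLineClassification.lean`) carried the
hypothesis `b = 0` (no clean component `V(w_m)` transversal to the centre — automatic for POINT centres, ✓ `eq_zero_of_span_centre_eq_maximalIdeal`, but
not for the CURVE centres of the `l = 1` successor analysis, memo 4e (B3)/(B4)).  Here the hypothesis is REMOVED by specialising the centre-free
side-family classification ✓ `cleanPermissibleAt_or_obstruction_of_sideFamily` (`…CleanProp44SideFamilyClassification.lean`):

* `exists_sideFamily_of_isBlowup` — THE SIDE FAMILY AT A POINT OF A BLOWING UP: for `τ : X' → X` a blowing up along `J` (`IsBlowup`), `x' ∈ X'`, a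
  regular system of parameters `(c, w)` of `𝒪_{X,τ x'}` with `(c) = J_{τ x'}`, a non-trivial representative `u · ∏ c_k^{a_k} · ∏ w_m^{b_m}` of the line of
  `G`, and `(e') = J 𝒪_{X',x'}`: a family `s : Fin r → 𝒪_{X',x'}` with `(e', s)` part of a regular system of parameters, exponents `ex`, a unit `V` with
  `Σ τ^♯c_j^p τ^♯G^j = V · e'^{Σ a} · ∏ s_j^{ex_j}`, every `s_j` being EITHER a charged clean side (`τ^♯ c_k = e' · s_j`, `ex_j = a_k`) OR a transversal
  component (`τ^♯ w_m = s_j`, `ex_j = b_m`), every `w_m` occurring, and every `c_k` with `a_k ≠ 0` either not passing through `x'`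
  (`(τ^♯ c_k) = J 𝒪_{X',x'}`) or occurring (repackaging of ✓ `exists_transform_normalForm_of_isBlowup`).
* `cleanPermissibleAt_exceptionalCurve_or_obstruction_of_sides` — for `dim 𝒪_{X',x'} = 3`, all shown exponents `a_k`, `b_m` zero or prime to `p`, and a
  regular curve germ `N = (e', z)` through `x'` inside the exceptional divisor (`(e', z, z') = 𝔪_{x'}`): CLEAN-PERMISSIBLE ∨ CORNER (two distinct sides
  through `x'` — charged `c`-sides with `a_k ≠ 0` or `w`-sides with `b_m ≠ 0` —, `(e', s₁, s₂) = 𝔪_{x'}`, neither in `N`) ∨ TANGENT (such a side in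
  `(N + 𝔪²) ∖ N`) ∨ BIRTH (`p ∣ Σ a_k`, no charged side with `a_k ≠ 0` through `x'`, ALL `b_m = 0`, and a unit `U` presenting the transform as `U · e'^A`
  which fails the non-birth test).  For `b = 0` this is ✓ `cleanPermissibleAt_exceptionalCurve_or_obstruction` again.
* `cleanPermissibleAt_sideTrace_or_birth` (local) / `cleanPermissibleAt_exceptionalTrace_or_birth` (scheme) — THE TRACE OF A TRANSVERSAL COMPONENT:
  for `N = (e', τ^♯ w_{m₀})` — the curve `E ∩ V(w_{m₀})'`; for a curve centre `Y` on a threefold (`l = 1`) this is THE FIBRE `E_x` of `E → Y` — there is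
  NO corner and NO tangency obstruction: `N` is clean-permissible unless `x'` is a birth (`p ∣ Σ a_k`, nothing charged through `x'`, all `b_m = 0`);
  `cleanPermissibleAt_exceptionalTrace_of_ne_zero` — in particular `b_{m₀} ≠ 0` makes `N` clean-permissible at EVERY point of it.

Honest framing: OURS, bookkeeping; a TOOL for the (R1ᵐⁱⁿ)/(R3ᵐⁱⁿ′) provers (curve centres: the fibres of the exceptional divisor are decided; the
horizontal successor curves `Γ″ ⊂ E_Y` fall under the general classification).  Nothing here proves X44c, any case of `CleanModels`, or resolution of
singularities in characteristic `p`.  Setting only: [cite: Piltant2013, §2 Axiom 4] [cite: CossartPiltant2008, Lemma 4.3 (4)–(5); Prop. 4.4 (proof)]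
[cite: GortzWedhorn2020, Prop. 13.91] [cite: DeJong1996, 2.4].
-/

noncomputable section

set_option linter.dupNamespace false -- mandated namespace of this single-conjunct summit

open IsLocalRing CategoryTheory AlgebraicGeometry
open Literature.AlgebraicGeometry.Resolution Literature.AlgebraicGeometry.Motives

namespace Summit.ResolutionOfSingularities.ResolutionOfSingularities.Theorems.RadicialJung.CleanModels

universe u

/-! ## §0 Local: the trace of a side has no corner and no tangency obstruction -/

/-- **The trace of a side is clean-permissible unless the point is a birth** (local form).  In the setting of
✓ `cleanPermissibleAt_or_obstruction_of_sideFamily` take `N = (e', s_{j₀})` — the curve cut on the exceptional divisor by the side `V(s_{j₀})` itself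
(`(e', s_{j₀}, z') = 𝔪`).  Then neither a corner (it would need two FURTHER sides — three sides in dimension `3`) nor a tangent side (a further side is
TRANSVERSAL to `N`, `(e', s_{j₀}, s_j)` being a regular system of parameters) can occur: the line is clean-permissible for `N`, or every exponent
vanishes, `p ∣ A`, and `V` fails the non-birth test. [cite: Piltant2013, §2 Axiom 4] [cite: CossartPiltant2008, Lemma 4.3 (5)] -/
theorem cleanPermissibleAt_sideTrace_or_birth {R : Type u} {F : Type u} [CommRing R] [IsLocalRing R] [Field F] {p : ℕ}
    [Fact p.Prime] [CharP F p] (f : R →+* F) (hf : Function.Injective f) (hdim : ringKrullDim R = 3) {e' : R} {r : ℕ} {s : Fin r → R}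
    (hrsop : IsRsopPart (Fin.cons e' s : Fin (r + 1) → R)) (j₀ : Fin r) {z' : R}
    (hzz : Ideal.span ({e', s j₀, z'} : Set R) = maximalIdeal R) {G : F} (cc : Fin p → F) (hcc : ∃ j : Fin p, (j : ℕ) ≠ 0 ∧ cc j ≠ 0)
    {V : R} (hV : IsUnit V) (A : ℕ) {ex : Fin r → ℕ} (hall : ∀ j, ex j = 0 ∨ ¬ p ∣ ex j)
    (hrep : (∑ j : Fin p, cc j ^ p * G ^ (j : ℕ)) = f (V * e' ^ A * ∏ j, s j ^ ex j)) :
    CleanPermissibleAt p f G (Ideal.span ({e', s j₀} : Set R)) ∨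
    (p ∣ A ∧ (∀ j, ex j = 0) ∧
      ¬ ((∀ c' : R, V - c' ^ p ∉ maximalIdeal R) ∨
          (∃ c' : R, V - c' ^ p ∈ maximalIdeal R ∧ V - c' ^ p ∉ Ideal.span ({e', s j₀} : Set R) ⊔ maximalIdeal R ^ 2) ∨
          (∃ c' : R, V - c' ^ p ∈ Ideal.span ({e', s j₀} : Set R) ∧ V - c' ^ p ∉ maximalIdeal R ^ 2))) := by
  rcases cleanPermissibleAt_or_obstruction_of_sideFamily f hf hdim hzz hrsop cc hcc hV A hall hrep with
    h | ⟨j₁, j₂, hne, -, -, -, hN₁, hN₂⟩ | ⟨j, -, hN, hmem⟩ | h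
  · exact Or.inl h
  · exfalso
    have hj₁ : j₁ ≠ j₀ := fun h => hN₁ (h ▸ Ideal.subset_span (by simp))
    have hj₂ : j₂ ≠ j₀ := fun h => hN₂ (h ▸ Ideal.subset_span (by simp))
    rcases fin_eq_or_eq_of_le_two (le_two_of_isRsopPart_cons hrsop hdim) hne j₀ with h | h
    · exact hj₁ h.symm
    · exact hj₂ h.symm
  · exfalso
    have hj : j₀ ≠ j := fun h => hN (h ▸ Ideal.subset_span (by simp))
    have htriple := isRsopPart_triple_of_cons hrsop hj
    have happ : (![e', s j₀, s j] : Fin 3 → R) = Fin.append ![e', s j₀] ![s j] := by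
      funext t; fin_cases t <;> rfl
    rw [happ] at htriple
    have h1 := append_right_not_mem_span_sup_sq htriple 0
    have hr : Set.range ![e', s j₀] = {e', s j₀} := by
      ext t
      simp only [Set.mem_range, Set.mem_insert_iff, Set.mem_singleton_iff]
      constructor
      · rintro ⟨i, rfl⟩
        fin_cases i <;> simp
      · rintro (rfl | rfl)
        exacts [⟨0, rfl⟩, ⟨1, rfl⟩]
    have h2 : s j ∈ Ideal.span (Set.range ![e', s j₀]) ⊔ maximalIdeal R ^ 2 := by rw [hr]; exact hmem
    exact h1 (by simpa using h2)
  · exact Or.inr h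

/-! ## §1 The side family at a point of a blowing up -/

section Scheme

variable {p : ℕ} {X X' : Scheme.{u}} [IsIntegral X] [IsIntegral X'] {τ : X' ⟶ X} [IsDominant τ]
  {J : X.IdealSheafData}

set_option maxHeartbeats 800000 in
-- stalk-level bookkeeping of a long existential statement
/-- **THE SIDE FAMILY AT A POINT OF A BLOWING UP.**  See the module docstring: the normal form ✓ `exists_transform_normalForm_of_isBlowup` repackaged
as a side family `(e', s)` (part of a regular system of parameters of `𝒪_{X',x'}`) with exponents `ex` and a unit `V`, the sides being the charged
clean sides (`τ^♯ c_k = e' · s_j`, `ex_j = a_k`) and the transversal components (`τ^♯ w_m = s_j`, `ex_j = b_m`); every `w_m` occurs; a `c_k` with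
`a_k ≠ 0` either does not pass through `x'` or occurs. [cite: DeJong1996, 2.4] [cite: GortzWedhorn2020, Prop. 13.91] -/
theorem exists_sideFamily_of_isBlowup (hτ : IsBlowup τ J) (x' : X')
    (hR : IsRegularLocalRing (X.presheaf.stalk (τ x'))) {n l : ℕ} (c : Fin n → X.presheaf.stalk (τ x'))
    (w : Fin l → X.presheaf.stalk (τ x')) (hz : Ideal.span (Set.range (Fin.append c w)) = maximalIdeal (X.presheaf.stalk (τ x')))
    (hdim : ringKrullDim (X.presheaf.stalk (τ x')) = ((n + l : ℕ) : WithBot ℕ∞))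
    (hcJ : Ideal.span (Set.range c) = stalkIdeal J (τ x'))
    {G : X.functionField} {cc : Fin p → X.functionField} (hcc : ∃ j : Fin p, (j : ℕ) ≠ 0 ∧ cc j ≠ 0)
    {u : X.presheaf.stalk (τ x')} (hu : IsUnit u) {a : Fin n → ℕ} {b : Fin l → ℕ}
    (hrep : (∑ j : Fin p, cc j ^ p * G ^ (j : ℕ)) = RatFn.toFunctionField (τ x') (u * (∏ k, c k ^ a k) * ∏ m, w m ^ b m))
    {e' : X'.presheaf.stalk x'} (he' : Ideal.span {e'} = (stalkIdeal J (τ x')).map (τ.stalkMap x').hom) :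
    ∃ (r : ℕ) (s : Fin r → X'.presheaf.stalk x') (ex : Fin r → ℕ) (V : X'.presheaf.stalk x'),
      IsRsopPart (Fin.cons e' s : Fin (r + 1) → X'.presheaf.stalk x') ∧ IsUnit V ∧
      (∃ j : Fin p, (j : ℕ) ≠ 0 ∧ RatFn.functionFieldMap τ (cc j) ≠ 0) ∧
      (∑ j : Fin p, RatFn.functionFieldMap τ (cc j) ^ p * RatFn.functionFieldMap τ G ^ (j : ℕ)) =
        RatFn.toFunctionField x' (V * e' ^ (∑ k, a k) * ∏ j, s j ^ ex j) ∧
      (∀ j, (∃ k, a k = ex j ∧ (τ.stalkMap x').hom (c k) = e' * s j) ∨ (∃ m, b m = ex j ∧ (τ.stalkMap x').hom (w m) = s j)) ∧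
      (∀ m, ∃ j, (τ.stalkMap x').hom (w m) = s j ∧ ex j = b m) ∧
      (∀ k, a k ≠ 0 → Ideal.span {(τ.stalkMap x').hom (c k)} = (stalkIdeal J (τ x')).map (τ.stalkMap x').hom ∨
        ∃ j, (τ.stalkMap x').hom (c k) = e' * s j ∧ ex j = a k) := by
  classical
  obtain ⟨i, uf, m, jJ, hrel, -, -, hch, hcomplete, hrsop, U, hU, -, heq⟩ :=
    exists_transform_normalForm_of_isBlowup hτ x' hR c w hz hdim hcJ a b hu
  have hR' : IsRegularLocalRing (X'.presheaf.stalk x') := hrsop.isRegularLocalRing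
  haveI := isDomain_of_isRegularLocalRing (X'.presheaf.stalk x')
  have hei : (τ.stalkMap x').hom (c i) ≠ 0 := by simpa using hrsop.ne_zero 0
  have hE : Ideal.span {(τ.stalkMap x').hom (c i)} = (stalkIdeal J (τ x')).map (τ.stalkMap x').hom := by
    rw [← hcJ]; exact span_singleton_eq_map_span_of_rel _ c i uf hrel
  obtain ⟨v, hv⟩ : Associated e' ((τ.stalkMap x').hom (c i)) := Ideal.span_singleton_eq_span_singleton.mp (he'.trans hE.symm)
  -- the side family and its exponents
  set s : Fin (m + l) → X'.presheaf.stalk x' := Fin.append (fun q => ↑v * uf (jJ q).1) (fun m' => (τ.stalkMap x').hom (w m')) with hs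
  set ex : Fin (m + l) → ℕ := Fin.append (fun q => a (jJ q).1) b with hex
  have hs_left : ∀ q, s (Fin.castAdd l q) = ↑v * uf (jJ q).1 := fun q => by rw [hs, Fin.append_left]
  have hs_right : ∀ m', s (Fin.natAdd m m') = (τ.stalkMap x').hom (w m') := fun m' => by rw [hs, Fin.append_right]
  have hex_left : ∀ q, ex (Fin.castAdd l q) = a (jJ q).1 := fun q => by rw [hex, Fin.append_left]
  have hex_right : ∀ m', ex (Fin.natAdd m m') = b m' := fun m' => by rw [hex, Fin.append_right]
  have hrsop' : IsRsopPart (Fin.cons e' s : Fin (m + l + 1) → X'.presheaf.stalk x') := by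
    refine hrsop.of_associated fun t => ?_
    rcases Fin.eq_zero_or_eq_succ t with rfl | ⟨t', rfl⟩
    · simp only [Fin.cons_zero]
      exact ⟨v⁻¹, by rw [← hv, mul_assoc, Units.mul_inv, mul_one]⟩
    · simp only [Fin.cons_succ]
      induction t' using Fin.addCases with
      | left q =>
        rw [Fin.append_left, hs_left]
        exact ⟨v, by rw [mul_comm]⟩
      | right m' =>
        rw [Fin.append_right, hs_right]
  -- the representative in side-family form
  set P : X'.presheaf.stalk x' := ∏ q, uf (jJ q).1 ^ a (jJ q).1 with hP
  set Q : X'.presheaf.stalk x' := ∏ m', (τ.stalkMap x').hom (w m') ^ b m' with hQ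
  have hPi : ∏ j, s j ^ ex j = ↑v ^ (∑ q, a (jJ q).1) * P * Q := by
    rw [Fin.prod_univ_add, hP, hQ]
    simp only [hs_left, hs_right, hex_left, hex_right, mul_pow, Finset.prod_mul_distrib, Finset.prod_pow_eq_pow_sum]
  set V : X'.presheaf.stalk x' := U * ↑v ^ (∑ k, a k) * ↑v⁻¹ ^ (∑ q, a (jJ q).1) with hV
  have hVu : IsUnit V := (hU.mul ((Units.isUnit v).pow _)).mul ((Units.isUnit v⁻¹).pow _)
  have heq' : (τ.stalkMap x').hom (u * (∏ k, c k ^ a k) * ∏ m', w m' ^ b m') = V * e' ^ (∑ k, a k) * ∏ j, s j ^ ex j := by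
    rw [heq, hPi, hV, ← hv, mul_pow]
    have hvv : (↑v⁻¹ : X'.presheaf.stalk x') ^ (∑ q, a (jJ q).1) * ↑v ^ (∑ q, a (jJ q).1) = 1 := by
      rw [← mul_pow, Units.inv_mul, one_pow]
    linear_combination (-(U * e' ^ (∑ k, a k) * (↑v : X'.presheaf.stalk x') ^ (∑ k, a k) * P * Q)) * hvv
  obtain ⟨hcc', hrep'⟩ := rep_functionFieldMap x' hcc hrep
  rw [heq'] at hrep'
  refine ⟨m + l, s, ex, V, hrsop', hVu, hcc', hrep', fun j => ?_, fun m' => ⟨Fin.natAdd m m', (hs_right m').symm, hex_right m'⟩,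
    fun k hk => ?_⟩
  · induction j using Fin.addCases with
    | left q =>
      left
      exact ⟨(jJ q).1, (hex_left q).symm, by rw [hs_left, hrel, ← hv, mul_assoc]⟩
    | right m' =>
      right
      exact ⟨m', (hex_right m').symm, (hs_right m').symm⟩
  · by_cases hki : k = i
    · left; rw [hki]; exact hE
    · by_cases hufk : IsUnit (uf k)
      · left; rw [hrel, Ideal.span_singleton_mul_right_unit hufk, hE]
      · right
        obtain ⟨q, hq⟩ := hcomplete k hki ((mem_maximalIdeal _).mpr hufk)
        refine ⟨Fin.castAdd l q, ?_, by rw [hex_left, hq]⟩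
        rw [hs_left, hq, hrel, ← hv, mul_assoc]

/-! ## §2 The classification without `b = 0` -/

set_option maxHeartbeats 800000 in
-- one long statement; the proof is a translation
/-- **THE LOCAL CLASSIFICATION at a point of the exceptional divisor, transversal clean components allowed: clean-permissible, or corner, or
tangent side, or birth.**  See the module docstring; a «side» is a charged clean side (`a_k ≠ 0`, `τ^♯ c_k = e' · s`) or a transversal clean
component (`b_m ≠ 0`, `τ^♯ w_m = s`); in the corner the two sides are distinct elements with `(e', s₁, s₂) = 𝔪_{x'}`.
[cite: Piltant2013, §2 Axiom 4] [cite: CossartPiltant2008, Lemma 4.3 (4)–(5); Prop. 4.4 (proof, p. 11)] -/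
theorem cleanPermissibleAt_exceptionalCurve_or_obstruction_of_sides [Fact p.Prime] [CharP X'.functionField p] (hτ : IsBlowup τ J)
    (x' : X') (hR : IsRegularLocalRing (X.presheaf.stalk (τ x'))) {n l : ℕ} (c : Fin n → X.presheaf.stalk (τ x'))
    (w : Fin l → X.presheaf.stalk (τ x')) (hz : Ideal.span (Set.range (Fin.append c w)) = maximalIdeal (X.presheaf.stalk (τ x')))
    (hdim : ringKrullDim (X.presheaf.stalk (τ x')) = ((n + l : ℕ) : WithBot ℕ∞))
    (hcJ : Ideal.span (Set.range c) = stalkIdeal J (τ x'))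
    {G : X.functionField} {cc : Fin p → X.functionField} (hcc : ∃ j : Fin p, (j : ℕ) ≠ 0 ∧ cc j ≠ 0)
    {u : X.presheaf.stalk (τ x')} (hu : IsUnit u) {a : Fin n → ℕ} {b : Fin l → ℕ}
    (hrep : (∑ j : Fin p, cc j ^ p * G ^ (j : ℕ)) = RatFn.toFunctionField (τ x') (u * (∏ k, c k ^ a k) * ∏ m, w m ^ b m))
    (hall : ∀ k, a k = 0 ∨ ¬ p ∣ a k) (hallb : ∀ m, b m = 0 ∨ ¬ p ∣ b m)
    (hdim' : ringKrullDim (X'.presheaf.stalk x') = 3) {e' z z' : X'.presheaf.stalk x'}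
    (he' : Ideal.span {e'} = (stalkIdeal J (τ x')).map (τ.stalkMap x').hom)
    (hzz : Ideal.span ({e', z, z'} : Set (X'.presheaf.stalk x')) = maximalIdeal (X'.presheaf.stalk x')) :
    CleanPermissibleAt p (RatFn.toFunctionField x') (RatFn.functionFieldMap τ G) (Ideal.span ({e', z} : Set (X'.presheaf.stalk x'))) ∨
    (∃ s₁ s₂ : X'.presheaf.stalk x', s₁ ≠ s₂ ∧
        ((∃ k, a k ≠ 0 ∧ (τ.stalkMap x').hom (c k) = e' * s₁) ∨ (∃ m, b m ≠ 0 ∧ (τ.stalkMap x').hom (w m) = s₁)) ∧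
        ((∃ k, a k ≠ 0 ∧ (τ.stalkMap x').hom (c k) = e' * s₂) ∨ (∃ m, b m ≠ 0 ∧ (τ.stalkMap x').hom (w m) = s₂)) ∧
        Ideal.span ({e', s₁, s₂} : Set (X'.presheaf.stalk x')) = maximalIdeal (X'.presheaf.stalk x') ∧
        s₁ ∉ Ideal.span ({e', z} : Set (X'.presheaf.stalk x')) ∧ s₂ ∉ Ideal.span ({e', z} : Set (X'.presheaf.stalk x'))) ∨
    (∃ s : X'.presheaf.stalk x',
        ((∃ k, a k ≠ 0 ∧ (τ.stalkMap x').hom (c k) = e' * s) ∨ (∃ m, b m ≠ 0 ∧ (τ.stalkMap x').hom (w m) = s)) ∧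
        s ∈ maximalIdeal (X'.presheaf.stalk x') ∧ s ∉ Ideal.span ({e', z} : Set (X'.presheaf.stalk x')) ∧
        s ∈ Ideal.span ({e', z} : Set (X'.presheaf.stalk x')) ⊔ maximalIdeal (X'.presheaf.stalk x') ^ 2) ∨
    (p ∣ ∑ k, a k ∧ (∀ k, a k ≠ 0 → Ideal.span {(τ.stalkMap x').hom (c k)} = (stalkIdeal J (τ x')).map (τ.stalkMap x').hom) ∧
      (∀ m, b m = 0) ∧
      ∃ U : X'.presheaf.stalk x', IsUnit U ∧
        (∑ j : Fin p, RatFn.functionFieldMap τ (cc j) ^ p * RatFn.functionFieldMap τ G ^ (j : ℕ)) =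
          RatFn.toFunctionField x' (U * e' ^ (∑ k, a k)) ∧
        ¬ ((∀ c' : X'.presheaf.stalk x', U - c' ^ p ∉ maximalIdeal (X'.presheaf.stalk x')) ∨
          (∃ c' : X'.presheaf.stalk x', U - c' ^ p ∈ maximalIdeal (X'.presheaf.stalk x') ∧
            U - c' ^ p ∉ Ideal.span ({e', z} : Set (X'.presheaf.stalk x')) ⊔ maximalIdeal (X'.presheaf.stalk x') ^ 2) ∨
          (∃ c' : X'.presheaf.stalk x', U - c' ^ p ∈ Ideal.span ({e', z} : Set (X'.presheaf.stalk x')) ∧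
            U - c' ^ p ∉ maximalIdeal (X'.presheaf.stalk x') ^ 2))) := by
  classical
  obtain ⟨r, s, ex, V, hrsop, hV, hcc', hrep', hdesc, hw, hc⟩ :=
    exists_sideFamily_of_isBlowup hτ x' hR c w hz hdim hcJ hcc hu hrep he'
  have hall' : ∀ j, ex j = 0 ∨ ¬ p ∣ ex j := by
    intro j
    rcases hdesc j with ⟨k, hk, -⟩ | ⟨m, hm, -⟩
    · rw [← hk]; exact hall k
    · rw [← hm]; exact hallb m
  have hside : ∀ j, ex j ≠ 0 →
      (∃ k, a k ≠ 0 ∧ (τ.stalkMap x').hom (c k) = e' * s j) ∨ (∃ m, b m ≠ 0 ∧ (τ.stalkMap x').hom (w m) = s j) := by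
    intro j hj
    rcases hdesc j with ⟨k, hk, hck⟩ | ⟨m, hm, hwm⟩
    · exact Or.inl ⟨k, by rw [hk]; exact hj, hck⟩
    · exact Or.inr ⟨m, by rw [hm]; exact hj, hwm⟩
  have hsm : ∀ j, s j ∈ maximalIdeal (X'.presheaf.stalk x') := fun j => by simpa using hrsop.mem_maximalIdeal j.succ
  rcases cleanPermissibleAt_or_obstruction_of_sideFamily (RatFn.toFunctionField x') (RatFn.toFunctionField_injective x') hdim' hzz hrsop
      _ hcc' hV (∑ k, a k) hall' hrep' with hperm | ⟨j₁, j₂, hne, hj₁, hj₂, h𝔪, hN₁, hN₂⟩ | ⟨j, hj, hN, hmem⟩ | ⟨hA, hall0, hnb⟩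
  · exact Or.inl hperm
  · right; left
    refine ⟨s j₁, s j₂, fun h => hne ?_, hside j₁ hj₁, hside j₂ hj₂, h𝔪, hN₁, hN₂⟩
    have h2 : (Fin.cons e' s : Fin (r + 1) → X'.presheaf.stalk x') j₁.succ = (Fin.cons e' s : Fin (r + 1) → X'.presheaf.stalk x') j₂.succ := by
      simp only [Fin.cons_succ, h]
    exact Fin.succ_injective _ (hrsop.injective h2)
  · right; right; left
    exact ⟨s j, hside j hj, hsm j, hN, hmem⟩
  · right; right; right
    refine ⟨hA, fun k hk => ?_, fun m => ?_, V, hV, ?_, hnb⟩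
    · rcases hc k hk with h | ⟨j, -, hj⟩
      · exact h
      · exact absurd (hj ▸ hall0 j : a k = 0) hk
    · obtain ⟨j, -, hj⟩ := hw m
      rw [← hj]; exact hall0 j
    · have hprod : ∏ j, s j ^ ex j = 1 := Finset.prod_eq_one fun j _ => by rw [hall0 j, pow_zero]
      rw [hrep', hprod, mul_one]

/-! ## §3 The trace of a transversal clean component (fibres of the exceptional divisor over a curve centre) -/

set_option maxHeartbeats 800000 in
-- one long statement; the proof is a translation
/-- **THE TRACE OF A TRANSVERSAL COMPONENT IS CLEAN-PERMISSIBLE UNLESS THE POINT IS A BIRTH.**  Same setting; `N = (e', τ^♯ w_{m₀})` the curve cut on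
the exceptional divisor by the strict transform of the clean component `V(w_{m₀})` transversal to the centre (`(e', τ^♯ w_{m₀}, z') = 𝔪_{x'}`); for a
curve centre `Y` on a threefold this is the FIBRE `E_x` of the exceptional divisor over `x = τ x'`.  Then the line of `τ^♯ G` is clean-permissible at `x'`
for `N`, or `x'` is a BIRTH: `p ∣ Σ a_k`, no charged side through `x'`, every `b_m = 0`, and a unit presenting the transform as `U · e'^A` fails the
non-birth test.  No corner, no tangency. [cite: Piltant2013, §2 Axiom 4] [cite: CossartPiltant2008, Lemma 4.3 (4)–(5)] -/
theorem cleanPermissibleAt_exceptionalTrace_or_birth [Fact p.Prime] [CharP X'.functionField p] (hτ : IsBlowup τ J)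
    (x' : X') (hR : IsRegularLocalRing (X.presheaf.stalk (τ x'))) {n l : ℕ} (c : Fin n → X.presheaf.stalk (τ x'))
    (w : Fin l → X.presheaf.stalk (τ x')) (hz : Ideal.span (Set.range (Fin.append c w)) = maximalIdeal (X.presheaf.stalk (τ x')))
    (hdim : ringKrullDim (X.presheaf.stalk (τ x')) = ((n + l : ℕ) : WithBot ℕ∞))
    (hcJ : Ideal.span (Set.range c) = stalkIdeal J (τ x'))
    {G : X.functionField} {cc : Fin p → X.functionField} (hcc : ∃ j : Fin p, (j : ℕ) ≠ 0 ∧ cc j ≠ 0)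
    {u : X.presheaf.stalk (τ x')} (hu : IsUnit u) {a : Fin n → ℕ} {b : Fin l → ℕ}
    (hrep : (∑ j : Fin p, cc j ^ p * G ^ (j : ℕ)) = RatFn.toFunctionField (τ x') (u * (∏ k, c k ^ a k) * ∏ m, w m ^ b m))
    (hall : ∀ k, a k = 0 ∨ ¬ p ∣ a k) (hallb : ∀ m, b m = 0 ∨ ¬ p ∣ b m)
    (hdim' : ringKrullDim (X'.presheaf.stalk x') = 3) (m₀ : Fin l) {e' z' : X'.presheaf.stalk x'}
    (he' : Ideal.span {e'} = (stalkIdeal J (τ x')).map (τ.stalkMap x').hom)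
    (hzz : Ideal.span ({e', (τ.stalkMap x').hom (w m₀), z'} : Set (X'.presheaf.stalk x')) = maximalIdeal (X'.presheaf.stalk x')) :
    CleanPermissibleAt p (RatFn.toFunctionField x') (RatFn.functionFieldMap τ G)
        (Ideal.span ({e', (τ.stalkMap x').hom (w m₀)} : Set (X'.presheaf.stalk x'))) ∨
    (p ∣ ∑ k, a k ∧ (∀ k, a k ≠ 0 → Ideal.span {(τ.stalkMap x').hom (c k)} = (stalkIdeal J (τ x')).map (τ.stalkMap x').hom) ∧
      (∀ m, b m = 0) ∧
      ∃ U : X'.presheaf.stalk x', IsUnit U ∧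
        (∑ j : Fin p, RatFn.functionFieldMap τ (cc j) ^ p * RatFn.functionFieldMap τ G ^ (j : ℕ)) =
          RatFn.toFunctionField x' (U * e' ^ (∑ k, a k)) ∧
        ¬ ((∀ c' : X'.presheaf.stalk x', U - c' ^ p ∉ maximalIdeal (X'.presheaf.stalk x')) ∨
          (∃ c' : X'.presheaf.stalk x', U - c' ^ p ∈ maximalIdeal (X'.presheaf.stalk x') ∧
            U - c' ^ p ∉ Ideal.span ({e', (τ.stalkMap x').hom (w m₀)} : Set (X'.presheaf.stalk x')) ⊔ maximalIdeal (X'.presheaf.stalk x') ^ 2) ∨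
          (∃ c' : X'.presheaf.stalk x', U - c' ^ p ∈ Ideal.span ({e', (τ.stalkMap x').hom (w m₀)} : Set (X'.presheaf.stalk x')) ∧
            U - c' ^ p ∉ maximalIdeal (X'.presheaf.stalk x') ^ 2))) := by
  classical
  obtain ⟨r, s, ex, V, hrsop, hV, hcc', hrep', hdesc, hw, hc⟩ :=
    exists_sideFamily_of_isBlowup hτ x' hR c w hz hdim hcJ hcc hu hrep he'
  have hall' : ∀ j, ex j = 0 ∨ ¬ p ∣ ex j := by
    intro j
    rcases hdesc j with ⟨k, hk, -⟩ | ⟨m, hm, -⟩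
    · rw [← hk]; exact hall k
    · rw [← hm]; exact hallb m
  obtain ⟨j₀, hj₀, -⟩ := hw m₀
  rw [hj₀] at hzz ⊢
  rcases cleanPermissibleAt_sideTrace_or_birth (RatFn.toFunctionField x') (RatFn.toFunctionField_injective x') hdim' hrsop j₀ hzz
      _ hcc' hV (∑ k, a k) hall' hrep' with hperm | ⟨hA, hall0, hnb⟩
  · exact Or.inl hperm
  · right
    refine ⟨hA, fun k hk => ?_, fun m => ?_, V, hV, ?_, hnb⟩
    · rcases hc k hk with h | ⟨j, -, hj⟩
      · exact h
      · exact absurd (hj ▸ hall0 j : a k = 0) hk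
    · obtain ⟨j, -, hj⟩ := hw m
      rw [← hj]; exact hall0 j
    · have hprod : ∏ j, s j ^ ex j = 1 := Finset.prod_eq_one fun j _ => by rw [hall0 j, pow_zero]
      rw [hrep', hprod, mul_one]

/-- **A charged transversal component makes its trace clean-permissible everywhere**: in the same setting, if `b_{m₀} ≠ 0` then `N = (e', τ^♯ w_{m₀})`
is clean-permissible at `x'` (for a curve centre on a threefold: the fibre `E_x` over a point `x` where a clean component with exponent prime to
`p` crosses the centre transversally is clean-permissible at each of its points). [cite: Piltant2013, §2 Axiom 4] -/
theorem cleanPermissibleAt_exceptionalTrace_of_ne_zero [Fact p.Prime] [CharP X'.functionField p] (hτ : IsBlowup τ J)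
    (x' : X') (hR : IsRegularLocalRing (X.presheaf.stalk (τ x'))) {n l : ℕ} (c : Fin n → X.presheaf.stalk (τ x'))
    (w : Fin l → X.presheaf.stalk (τ x')) (hz : Ideal.span (Set.range (Fin.append c w)) = maximalIdeal (X.presheaf.stalk (τ x')))
    (hdim : ringKrullDim (X.presheaf.stalk (τ x')) = ((n + l : ℕ) : WithBot ℕ∞))
    (hcJ : Ideal.span (Set.range c) = stalkIdeal J (τ x'))
    {G : X.functionField} {cc : Fin p → X.functionField} (hcc : ∃ j : Fin p, (j : ℕ) ≠ 0 ∧ cc j ≠ 0)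
    {u : X.presheaf.stalk (τ x')} (hu : IsUnit u) {a : Fin n → ℕ} {b : Fin l → ℕ}
    (hrep : (∑ j : Fin p, cc j ^ p * G ^ (j : ℕ)) = RatFn.toFunctionField (τ x') (u * (∏ k, c k ^ a k) * ∏ m, w m ^ b m))
    (hall : ∀ k, a k = 0 ∨ ¬ p ∣ a k) (hallb : ∀ m, b m = 0 ∨ ¬ p ∣ b m)
    (hdim' : ringKrullDim (X'.presheaf.stalk x') = 3) (m₀ : Fin l) (hm₀ : b m₀ ≠ 0) {e' z' : X'.presheaf.stalk x'}
    (he' : Ideal.span {e'} = (stalkIdeal J (τ x')).map (τ.stalkMap x').hom)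
    (hzz : Ideal.span ({e', (τ.stalkMap x').hom (w m₀), z'} : Set (X'.presheaf.stalk x')) = maximalIdeal (X'.presheaf.stalk x')) :
    CleanPermissibleAt p (RatFn.toFunctionField x') (RatFn.functionFieldMap τ G)
        (Ideal.span ({e', (τ.stalkMap x').hom (w m₀)} : Set (X'.presheaf.stalk x'))) := by
  rcases cleanPermissibleAt_exceptionalTrace_or_birth hτ x' hR c w hz hdim hcJ hcc hu hrep hall hallb hdim' m₀ he' hzz with h | ⟨-, -, hb, -⟩
  · exact h
  · exact absurd (hb m₀) hm₀

end Scheme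

end Summit.ResolutionOfSingularities.ResolutionOfSingularities.Theorems.RadicialJung.CleanModels

end
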